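import Literature.RepresentationTheory.KonnoKonno2007.RealUnitaryDualPairSL2
import HarnessLib

/-!
# The `KAK` decomposition of the real-rank-one unitary group `U(α,β)`, `|β| = 1` — group side, kernel

Topic `RepresentationTheory/KonnoKonno2007`; namespace `Literature.RepresentationTheory.KonnoKonno2007.RealDualPair`.
KERNEL ONLY: 0 records, 0 `Prop`-valued definitions, 0 hypotheses; every statement is a kernel fact about the
explicit matrices of `RealUnitaryDualPair` / `RealUnitaryDualPairSL2` (tag `folklore`).

Setting of `RealUnitaryDualPairSL2` (FILE B of the `mc-unitary-2` lane): `UForm α β = U(α,β)` is the unitary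
group of the hermitian form `diag(1_α, −1_β)` on `ℂ^{α ⊕ β}`, `UForm.kV : U(α) × U(β) →* U(α,β)` its block-diagonal
maximal compact subgroup `K`, and for a hyperbolic plane `{e_{p₀}, e_{q₀}}` (`p₀ ∈ α`, `q₀ ∈ β`) the embedded
`SU(1,1) ≅ SL(2,ℝ)` is `φV p₀ q₀ : SL(2,ℝ) →* U(α,β)` (Cayley conjugate planted in the plane).  We define

* `slExp t = diag(eᵗ, e⁻ᵗ) ∈ SL(2,ℝ)` and the **hyperbolic one-parameter group** `hypV p₀ q₀ t = φV (slExp t)`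
  (`= a_t`; matrix `plant p₀ q₀ !![cosh t, −i sinh t; i sinh t, cosh t]`, `coe_hypV`), with `hypV_add`,
  `hypV_zero`, `hypV_neg`, the entry table `hypV_inl_inl/…/hypV_inr_inr`, `continuous_hypV`;
* the **`KAK` map** `kakMap p₀ q₀ : K × ℝ × K → U(α,β)`, `(k₁, t, k₂) ↦ k₁ a_t k₂` (`K = KV α β = U(α) × U(β)`),
  `continuous_kakMap`;
* the **Weyl element** `weylKV p₀ = (diag(−1 at p₀, 1 elsewhere), 1) ∈ K` with `kV_weylKV_mul_hypV_mul_inv :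
  w a_t w⁻¹ = a_{−t}` (`exists_weyl`);

and prove, for `|β| = 1` (`[Subsingleton β]`, real rank one — the groups `U(n,1)(ℝ)`):

* **properness** `isProperMap_kakMap` — through the continuous gauge `g ↦ ‖g_{q₀q₀}‖` (`gauge`), whose composite
  with `kakMap` is `(k₁,t,k₂) ↦ cosh t` (`gauge_kakMap`; a `1 × 1` unitary has modulus one), proper because `K` is
  compact (`Matrix.isCompact_unitaryGroup`) and `cosh` is proper (`isProperMap_cosh`, `|t| ≤ cosh t`); hence
  `isClosedMap_kakMap`, `isCompact_preimage_kakMap`;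
* **surjectivity** `kakMap_surjective`, `exists_kV_mul_hypV_mul_kV_eq : ∀ g, ∃ k₁ k₂ t, 0 ≤ t ∧ g = k₁ a_t k₂`
  (`kakMap_image_nonneg`) — by the elementary column argument: the `q₀`-column `(v, x)` of `g` satisfies
  `|x|² − ‖v‖² = 1` (`UForm.form_apply`, the identity `gᴴ J g = J` by entries), so it is the `q₀`-column of
  `k₁ a_t` with `sinh t = ‖v‖`, `k₁ = (u, x/|x|)`, `u e_{p₀} = (i/‖v‖) v` (`exists_unitaryGroup_col_eq`: a unit
  vector is a column of a unitary matrix, via `Orthonormal.exists_orthonormalBasis_extension_of_card_eq`;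
  `exists_kV_mul_hypV_col_eq`); then `(k₁ a_t)⁻¹ g` fixes `e_{q₀}`, and the stabiliser of `e_{q₀}` in `U(α,β)`
  is `U(α) × 1` (`exists_eq_kV_of_col_eq`);
* the **quotient-map corollaries** `isQuotientMap_kakMap`, `isQuotientMap_kakMap_prodMap X` (for `kakMap × id_X`,
  from `IsProperMap.prodMap`), `continuous_iff_comp_kakMap`, `continuous_iff_comp_kakMap_prodMap` — continuity
  (resp. joint continuity with a parameter) on `U(α,β)` descends from continuity in `(k₁, t, k₂)`;
* §9, the **dual pair** `Ginf P Q R S = U(P,Q) × U(R,S)` with `|Q| = |S| = 1` (e.g. `U(2,1) × U(1,1)`): the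
  two-parameter map `kakMap₂ p₀ q₀ r₀ s₀ : (K × K′) × ℝ² × (K × K′) → U(P,Q) × U(R,S)`,
  `(k, (t,s), k') ↦ κ k · (a_t, a′_s) · κ k'`, is continuous, PROPER, surjective and a quotient map
  (`isProperMap_kakMap₂`, `kakMap₂_surjective`, `isQuotientMap_kakMap₂(_prodMap)`), the pair of Weyl elements
  `κ_weyl_conj`, and the bridge `φ_slExp : φ R S p₀ q₀ (slExp t) = (hypV p₀ q₀ t, 1)` (`rfl`) to the carrier
  `φ R S p₀ q₀ (slDiag (exp t))` of the embedded `SL(2,ℝ)` of FILE B;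
* §10, the **pair with a compact second factor** (the archimedean pair `(U(2,1), U(1))`,
  `(P,Q,R,S) = (Fin 2, Unit, Unit, Empty)`): `kakMapPair p₀ q₀ : (K × K′) × ℝ × (K × K′) → U(P,Q) × U(R,S)`,
  `(k, t, k') ↦ κ k · φ(diag(eᵗ,e⁻ᵗ)) · κ k'`, continuous and PROPER for `|Q| = 1` (`isProperMap_kakMapPair`), and
  surjective / a quotient map (`kakMapPair_surjective`, `isQuotientMap_kakMapPair(_prodMap)`) under the hypothesis
  `Function.Surjective (UForm.kV R S)` (true for a definite `W`); Weyl element `κ_weylKV_conj_φ_slExp`.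

Provenance (statement shape only; nothing is cited as a hypothesis): the Cartan decomposition `G = K A⁺ K` of a
semisimple Lie group [Knapp2002, Thm. 7.39], [Helgason1978, Ch. IX, Thm. 1.1]; for `U(n,1)` the split component
`A` is one-dimensional and the decomposition is the elementary statement proved here.  The properness of
`K × A × K → G` (compact `K`, `A ≅ ℝ` entering through `cosh`) is the form in which the decomposition is used to
descend continuity statements for representations of `G` to the three factors (the consumer is the archimedean
Weil-representation continuity argument of `Literature.NumberTheory.Weil1964`).

BOUNDARY.  This file imports only `RealUnitaryDualPairSL2` (tree) and Mathlib through it; it introduces no record,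
no `Prop` definition and no cited fact, and it neither states nor uses anything specific to the Hodge/Picard
programme: it is a reproduction-side kernel leaf about explicit matrix groups.

References: [Knapp2002] A. W. Knapp, *Lie Groups Beyond an Introduction*, 2nd ed., Thm. 7.39; [Helgason1978]
S. Helgason, *Differential Geometry, Lie Groups, and Symmetric Spaces*, Ch. IX §1; [KonnoKonno2007] §3.1 (the pair
`U(2,1) × U(1,1)` and its maximal compact subgroups).
-/

set_option autoImplicit false

noncomputable section

open Matrix Complex Topology Filter
open scoped ComplexConjugate

namespace Literature.RepresentationTheory.KonnoKonno2007

namespace RealDualPair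

open Literature.NumberTheory.Automorphic Literature.NumberTheory.Automorphic.UnitaryGroup
open Literature.LinearAlgebra.Matrix.RotationThreeShears Literature.Analysis.SegalBargmann

/-! ## 1. The split torus `t ↦ D(eᵗ)` of `SL(2,ℝ)` and its Cayley conjugate -/

section Torus

/-- the hyperbolic one-parameter subgroup `t ↦ D(eᵗ) = diag(eᵗ, e⁻ᵗ)` of `SL(2,ℝ)`. [folklore] -/
def slExp (t : ℝ) : Matrix.SpecialLinearGroup (Fin 2) ℝ := slDiag (Real.exp t) (Real.exp_pos t).ne'

/-- coercion of `slExp t`. [folklore] -/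
@[simp] theorem coe_slExp (t : ℝ) :
    ((slExp t : Matrix.SpecialLinearGroup (Fin 2) ℝ) : Matrix (Fin 2) (Fin 2) ℝ) =
      !![Real.exp t, 0; 0, Real.exp (-t)] := by
  rw [slExp, coe_slDiag, Real.exp_neg]

/-- `D(e^{s+t}) = D(eˢ) D(eᵗ)`. [folklore] -/
theorem slExp_add (s t : ℝ) : slExp (s + t) = slExp s * slExp t := by
  ext i j
  simp only [Matrix.SpecialLinearGroup.coe_mul, coe_slExp]
  fin_cases i <;> fin_cases j <;> simp [Matrix.mul_apply, Fin.sum_univ_two, Real.exp_add, mul_comm]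

/-- `D(e⁰) = 1`. [folklore] -/
@[simp] theorem slExp_zero : slExp 0 = 1 := by
  ext i j
  simp only [Matrix.SpecialLinearGroup.coe_one, coe_slExp]
  fin_cases i <;> fin_cases j <;> simp

/-- `D(e^{-t}) = D(eᵗ)⁻¹`. [folklore] -/
theorem slExp_neg (t : ℝ) : slExp (-t) = (slExp t)⁻¹ := by
  rw [eq_inv_iff_mul_eq_one, ← slExp_add, neg_add_cancel, slExp_zero]

/-- `t ↦ D(eᵗ)` is continuous (as a matrix-valued map). [folklore] -/
theorem continuous_coe_slExp :
    Continuous fun t : ℝ => ((slExp t : Matrix.SpecialLinearGroup (Fin 2) ℝ) : Matrix (Fin 2) (Fin 2) ℝ) := by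
  simp only [coe_slExp]
  refine continuous_pi fun i => continuous_pi fun j => ?_
  fin_cases i <;> fin_cases j <;> simp <;> fun_prop

/-- **The Cayley conjugate of the split torus is the `SU(1,1)`-boost**
`cay D(eᵗ) = !![cosh t, −i sinh t; i sinh t, cosh t]`. [folklore] -/
theorem cay_slExp (t : ℝ) :
    cay ((slExp t : Matrix.SpecialLinearGroup (Fin 2) ℝ) : Matrix (Fin 2) (Fin 2) ℝ) =
      !![(Real.cosh t : ℂ), -(Real.sinh t : ℂ) * I; (Real.sinh t : ℂ) * I, (Real.cosh t : ℂ)] := by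
  rw [coe_slExp]
  ext i j
  fin_cases i <;> fin_cases j <;> simp [cay, Real.cosh_eq, Real.sinh_eq]
  all_goals ring

/-- `cay` is continuous. [folklore] -/
theorem continuous_cay : Continuous cay := by
  refine continuous_pi fun i => continuous_pi fun j => ?_
  fin_cases i <;> fin_cases j
  · show Continuous fun g => cay g 0 0
    simp only [cay_apply_00]; fun_prop
  · show Continuous fun g => cay g 0 1
    simp only [cay_apply_01]; fun_prop
  · show Continuous fun g => cay g 1 0
    simp only [cay_apply_10]; fun_prop
  · show Continuous fun g => cay g 1 1
    simp only [cay_apply_11]; fun_prop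

end Torus

/-! ## 2. `plant` is continuous; the hyperbolic subgroup `hypV p₀ q₀` of `U(α,β)` -/

section Hyp

variable {α β : Type*} [Fintype α] [DecidableEq α] [Fintype β] [DecidableEq β] (p₀ : α) (q₀ : β)

omit [Fintype α] [Fintype β] in
/-- `plant p₀ q₀` is continuous. [folklore] -/
theorem continuous_plant : Continuous (plant (P := α) (Q := β) p₀ q₀) := by
  refine continuous_pi fun i => continuous_pi fun j => ?_
  rcases i with a | b <;> rcases j with a' | b'
  · simp only [plant_inl_inl]
    by_cases h : a = p₀ <;> by_cases h' : a' = p₀ <;> simp [h, h'] <;> fun_prop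
  · simp only [plant_inl_inr]
    by_cases h : a = p₀ ∧ b' = q₀ <;> simp [h] <;> fun_prop
  · simp only [plant_inr_inl]
    by_cases h : b = q₀ ∧ a' = p₀ <;> simp [h] <;> fun_prop
  · simp only [plant_inr_inr]
    by_cases h : b = q₀ <;> by_cases h' : b' = q₀ <;> simp [h, h'] <;> fun_prop

/-- **The hyperbolic one-parameter subgroup** `a_t = φV p₀ q₀ (D(eᵗ))` of `U(α,β)`: the `SU(1,1)`-boost
`!![cosh t, −i sinh t; i sinh t, cosh t]` planted on the hyperbolic plane `{e_{p₀}, e_{q₀}}`, the identity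
elsewhere (the split component `A` of `U(α,β)` when `|β| = 1`). [folklore] -/
def hypV (t : ℝ) : UForm α β := φV p₀ q₀ (slExp t)

/-- the matrix of `hypV p₀ q₀ t`. [folklore] -/
@[simp] theorem coe_hypV (t : ℝ) :
    (((hypV p₀ q₀ t : UForm α β) : GL (α ⊕ β) ℂ) : Matrix (α ⊕ β) (α ⊕ β) ℂ) =
      plant p₀ q₀ !![(Real.cosh t : ℂ), -(Real.sinh t : ℂ) * I; (Real.sinh t : ℂ) * I, (Real.cosh t : ℂ)] := by
  rw [← cay_slExp]; rfl

/-- `a_{s+t} = a_s a_t`. [folklore] -/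
theorem hypV_add (s t : ℝ) : hypV p₀ q₀ (s + t) = (hypV p₀ q₀ s : UForm α β) * hypV p₀ q₀ t := by
  rw [hypV, slExp_add, map_mul]; rfl

/-- `a_0 = 1`. [folklore] -/
@[simp] theorem hypV_zero : (hypV p₀ q₀ 0 : UForm α β) = 1 := by
  rw [hypV, slExp_zero, map_one]

/-- `a_{-t} = a_t⁻¹`. [folklore] -/
theorem hypV_neg (t : ℝ) : (hypV p₀ q₀ (-t) : UForm α β) = (hypV p₀ q₀ t)⁻¹ := by
  rw [hypV, slExp_neg, map_inv]; rfl

/-- entries of `a_t`, block `(α, α)`. [folklore] -/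
theorem hypV_inl_inl (t : ℝ) (a a' : α) :
    (((hypV p₀ q₀ t : UForm α β) : GL (α ⊕ β) ℂ) : Matrix (α ⊕ β) (α ⊕ β) ℂ) (Sum.inl a) (Sum.inl a') =
      if a = p₀ then (if a' = p₀ then (Real.cosh t : ℂ) else 0) else (if a' = a then 1 else 0) := by
  rw [coe_hypV, plant_inl_inl]; rfl

/-- entries of `a_t`, block `(α, β)`. [folklore] -/
theorem hypV_inl_inr (t : ℝ) (a : α) (b : β) :
    (((hypV p₀ q₀ t : UForm α β) : GL (α ⊕ β) ℂ) : Matrix (α ⊕ β) (α ⊕ β) ℂ) (Sum.inl a) (Sum.inr b) =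
      if a = p₀ ∧ b = q₀ then -(Real.sinh t : ℂ) * I else 0 := by
  rw [coe_hypV, plant_inl_inr]; rfl

/-- entries of `a_t`, block `(β, α)`. [folklore] -/
theorem hypV_inr_inl (t : ℝ) (b : β) (a' : α) :
    (((hypV p₀ q₀ t : UForm α β) : GL (α ⊕ β) ℂ) : Matrix (α ⊕ β) (α ⊕ β) ℂ) (Sum.inr b) (Sum.inl a') =
      if b = q₀ ∧ a' = p₀ then (Real.sinh t : ℂ) * I else 0 := by
  rw [coe_hypV, plant_inr_inl]; rfl

/-- entries of `a_t`, block `(β, β)`. [folklore] -/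
theorem hypV_inr_inr (t : ℝ) (b b' : β) :
    (((hypV p₀ q₀ t : UForm α β) : GL (α ⊕ β) ℂ) : Matrix (α ⊕ β) (α ⊕ β) ℂ) (Sum.inr b) (Sum.inr b') =
      if b = q₀ then (if b' = q₀ then (Real.cosh t : ℂ) else 0) else (if b' = b then 1 else 0) := by
  rw [coe_hypV, plant_inr_inr]; rfl

/-- **`t ↦ a_t` is continuous.** [folklore] -/
theorem continuous_hypV : Continuous (hypV p₀ q₀ : ℝ → UForm α β) := by
  have hval : Continuous fun t : ℝ => (((hypV p₀ q₀ t : UForm α β) : GL (α ⊕ β) ℂ) : Matrix (α ⊕ β) (α ⊕ β) ℂ) := by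
    have : (fun t : ℝ => (((hypV p₀ q₀ t : UForm α β) : GL (α ⊕ β) ℂ) : Matrix (α ⊕ β) (α ⊕ β) ℂ)) =
        fun t => plant p₀ q₀ (cay ((slExp t : Matrix.SpecialLinearGroup (Fin 2) ℝ) : Matrix (Fin 2) (Fin 2) ℝ)) := by
      funext t; rfl
    rw [this]
    exact (continuous_plant p₀ q₀).comp (continuous_cay.comp continuous_coe_slExp)
  refine Continuous.subtype_mk (Units.continuous_iff.2 ⟨hval, ?_⟩) _
  have : (fun t : ℝ => ((((hypV p₀ q₀ t : UForm α β) : GL (α ⊕ β) ℂ)⁻¹ : GL (α ⊕ β) ℂ) : Matrix (α ⊕ β) (α ⊕ β) ℂ)) =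
      fun t => (((hypV p₀ q₀ (-t) : UForm α β) : GL (α ⊕ β) ℂ) : Matrix (α ⊕ β) (α ⊕ β) ℂ) := by
    funext t; rw [hypV_neg]; rfl
  rw [this]
  exact hval.comp continuous_neg

end Hyp

/-! ## 3. The multiplication map `K × A × K → G` -/

section KAK

variable (α β : Type*) [Fintype α] [DecidableEq α] [Fintype β] [DecidableEq β]

/-- the maximal compact `K = U(α) × U(β)` (block-unitary matrices), as a type. [folklore] -/
abbrev KV : Type _ := Matrix.unitaryGroup α ℂ × Matrix.unitaryGroup β ℂ

variable {α β} (p₀ : α) (q₀ : β)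

/-- **The `KAK` multiplication map** `(k₁, t, k₂) ↦ k₁ a_t k₂ : K × ℝ × K → U(α,β)`. [cite: Knapp2002, Thm 7.39] -/
def kakMap (x : KV α β × ℝ × KV α β) : UForm α β :=
  UForm.kV α β x.1 * hypV p₀ q₀ x.2.1 * UForm.kV α β x.2.2

/-- unfolding `kakMap`. [folklore] -/
theorem kakMap_apply (k₁ : KV α β) (t : ℝ) (k₂ : KV α β) :
    kakMap p₀ q₀ (k₁, t, k₂) = UForm.kV α β k₁ * hypV p₀ q₀ t * UForm.kV α β k₂ := rfl

/-- **`kakMap` is continuous.** [folklore] -/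
theorem continuous_kakMap : Continuous (kakMap p₀ q₀ : KV α β × ℝ × KV α β → UForm α β) :=
  ((UForm.continuous_kV.comp continuous_fst).mul
    ((continuous_hypV p₀ q₀).comp (continuous_fst.comp continuous_snd))).mul
    (UForm.continuous_kV.comp (continuous_snd.comp continuous_snd))

end KAK

/-! ## 4. Block computations: the form identity, the `(q₀,q₀)` gauge -/

section Blocks

variable {α β : Type*} [Fintype α] [DecidableEq α] [Fintype β] [DecidableEq β]

/-- entries of `Mᴴ · diag(1_α, −1_β) · M`: `Σ_a conj(M_{a i}) M_{a j} − Σ_b conj(M_{b i}) M_{b j}`. [folklore] -/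
theorem conjTranspose_mul_signForm_mul_apply (M : Matrix (α ⊕ β) (α ⊕ β) ℂ) (i j : α ⊕ β) :
    (Mᴴ * signForm α β * M) i j =
      (∑ a, star (M (Sum.inl a) i) * M (Sum.inl a) j) - ∑ b, star (M (Sum.inr b) i) * M (Sum.inr b) j := by
  rw [signForm_eq_diagonal, Matrix.mul_apply, Fintype.sum_sum_type]
  simp only [Matrix.mul_diagonal, Matrix.conjTranspose_apply, Sum.elim_inl, Sum.elim_inr, mul_one,
    mul_neg, neg_mul, Finset.sum_neg_distrib, sub_eq_add_neg]

/-- **the defining identity of `U(α,β)` by entries**: for `g ∈ U(α,β)` with matrix `M`,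
`Σ_a conj(M_{a i}) M_{a j} − Σ_b conj(M_{b i}) M_{b j} = diag(1_α, −1_β)_{i j}`. [folklore] -/
theorem UForm.form_apply (g : UForm α β) (i j : α ⊕ β) :
    (∑ a, star ((((g : UForm α β) : GL (α ⊕ β) ℂ) : Matrix (α ⊕ β) (α ⊕ β) ℂ) (Sum.inl a) i) *
        (((g : UForm α β) : GL (α ⊕ β) ℂ) : Matrix (α ⊕ β) (α ⊕ β) ℂ) (Sum.inl a) j) -
      ∑ b, star ((((g : UForm α β) : GL (α ⊕ β) ℂ) : Matrix (α ⊕ β) (α ⊕ β) ℂ) (Sum.inr b) i) *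
        (((g : UForm α β) : GL (α ⊕ β) ℂ) : Matrix (α ⊕ β) (α ⊕ β) ℂ) (Sum.inr b) j =
      signForm α β i j := by
  rw [← conjTranspose_mul_signForm_mul_apply, (mem_unitaryGroupOfForm_star_iff_conjTranspose _ _).1 g.2]

/-- matrix of a product in `U(α,β)`. [folklore] -/
theorem UForm.coe_mul (g h : UForm α β) :
    (((g * h : UForm α β) : GL (α ⊕ β) ℂ) : Matrix (α ⊕ β) (α ⊕ β) ℂ) =
      (((g : UForm α β) : GL (α ⊕ β) ℂ) : Matrix (α ⊕ β) (α ⊕ β) ℂ) *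
        (((h : UForm α β) : GL (α ⊕ β) ℂ) : Matrix (α ⊕ β) (α ⊕ β) ℂ) := rfl

/-- matrix of `1 ∈ U(α,β)`. [folklore] -/
theorem UForm.coe_one :
    (((1 : UForm α β) : GL (α ⊕ β) ℂ) : Matrix (α ⊕ β) (α ⊕ β) ℂ) = 1 := rfl

/-- a `1 × 1` unitary matrix has its entry on the unit circle: for `β` a singleton and `Z ∈ U(β)`,
`‖Z_{q₀ q₀}‖ = 1`. [folklore] -/
theorem norm_entry_unitary_subsingleton [Subsingleton β] (Z : Matrix.unitaryGroup β ℂ) (q₀ : β) :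
    ‖(Z : Matrix β β ℂ) q₀ q₀‖ = 1 := by
  have h := congrFun (congrFun (Matrix.UnitaryGroup.star_mul_self Z) q₀) q₀
  rw [Matrix.mul_apply, Fintype.sum_subsingleton _ q₀, Matrix.star_apply, Matrix.one_apply_eq,
    Complex.star_def, Complex.conj_mul'] at h
  have h' : ‖(Z : Matrix β β ℂ) q₀ q₀‖ ^ 2 = 1 := by exact_mod_cast h
  exact (pow_eq_one_iff_of_nonneg (norm_nonneg _) two_ne_zero).1 h'

variable (p₀ : α) (q₀ : β)

/-- **the `(q₀,q₀)` entry of `k₁ a_t k₂`** (`β` a singleton): `(k₁)_{q₀q₀} · cosh t · (k₂)_{q₀q₀}`. [folklore] -/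
theorem kakMap_inr_inr [Subsingleton β] (k₁ : KV α β) (t : ℝ) (k₂ : KV α β) :
    (((kakMap p₀ q₀ (k₁, t, k₂) : UForm α β) : GL (α ⊕ β) ℂ) : Matrix (α ⊕ β) (α ⊕ β) ℂ)
        (Sum.inr q₀) (Sum.inr q₀) =
      (k₁.2 : Matrix β β ℂ) q₀ q₀ * (Real.cosh t : ℂ) * (k₂.2 : Matrix β β ℂ) q₀ q₀ := by
  rw [kakMap_apply, UForm.coe_mul, UForm.coe_mul, Matrix.mul_apply, Fintype.sum_sum_type]
  simp only [UForm.coe_kV, Matrix.fromBlocks_apply₁₂, Matrix.zero_apply, mul_zero,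
    Finset.sum_const_zero, zero_add, Matrix.fromBlocks_apply₂₂, Fintype.sum_subsingleton _ q₀]
  rw [Matrix.mul_apply, Fintype.sum_sum_type]
  simp only [Matrix.fromBlocks_apply₂₁, Matrix.zero_apply, zero_mul, Finset.sum_const_zero, zero_add,
    Matrix.fromBlocks_apply₂₂, Fintype.sum_subsingleton _ q₀, hypV_inr_inr, if_true]

/-- **the gauge**: `g ↦ ‖g_{q₀q₀}‖` on `U(α,β)`. [folklore] -/
def gauge (g : UForm α β) : ℝ :=
  ‖(((g : UForm α β) : GL (α ⊕ β) ℂ) : Matrix (α ⊕ β) (α ⊕ β) ℂ) (Sum.inr q₀) (Sum.inr q₀)‖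

/-- the gauge is continuous. [folklore] -/
theorem continuous_gauge : Continuous (gauge q₀ : UForm α β → ℝ) :=
  ((Units.continuous_val.comp continuous_subtype_val).matrix_elem (Sum.inr q₀) (Sum.inr q₀)).norm

/-- **the gauge of `k₁ a_t k₂` is `cosh t`** (`β` a singleton). [folklore] -/
theorem gauge_kakMap [Subsingleton β] (x : KV α β × ℝ × KV α β) :
    gauge q₀ (kakMap p₀ q₀ x) = Real.cosh x.2.1 := by
  obtain ⟨k₁, t, k₂⟩ := x
  rw [gauge, kakMap_inr_inr, norm_mul, norm_mul, norm_entry_unitary_subsingleton,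
    norm_entry_unitary_subsingleton, Complex.norm_real, Real.norm_eq_abs, abs_of_pos (Real.cosh_pos t)]
  ring

end Blocks

/-! ## 5. Properness, closedness -/

section Proper

variable {α β : Type*} [Fintype α] [DecidableEq α] [Fintype β] [DecidableEq β] (p₀ : α) (q₀ : β)

/-- `|t| ≤ cosh t`. [folklore] -/
theorem abs_le_cosh (t : ℝ) : |t| ≤ Real.cosh t := by
  rw [← Real.cosh_abs]
  exact (Real.self_le_sinh_iff.2 (abs_nonneg t)).trans (Real.sinh_lt_cosh _).le

/-- **`cosh : ℝ → ℝ` is a proper map.** [folklore] -/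
theorem isProperMap_cosh : IsProperMap Real.cosh := by
  rw [isProperMap_iff_isCompact_preimage]
  refine ⟨Real.continuous_cosh, fun K hK => ?_⟩
  obtain ⟨M, hM⟩ := hK.isBounded.subset_closedBall 0
  refine (isCompact_Icc (a := -M) (b := M)).of_isClosed_subset (hK.isClosed.preimage Real.continuous_cosh)
    fun t ht => ?_
  have h1 : Real.cosh t ≤ M := by
    have := hM ht
    rw [Metric.mem_closedBall, dist_zero_right, Real.norm_eq_abs, abs_of_pos (Real.cosh_pos t)] at this
    exact this
  exact Set.mem_Icc.2 (abs_le.1 ((abs_le_cosh t).trans h1))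

/-- **`kakMap` is a proper map** (`β` a singleton): its composite with the continuous gauge is
`(k₁, t, k₂) ↦ cosh t`, which is proper because `K` is compact and `cosh` is proper; a continuous map whose
composite with a continuous map to a Hausdorff space is proper is itself proper. [folklore] -/
theorem isProperMap_kakMap [Subsingleton β] : IsProperMap (kakMap p₀ q₀ : KV α β × ℝ × KV α β → UForm α β) := by
  haveI : CompactSpace (Matrix.unitaryGroup α ℂ) := isCompact_iff_compactSpace.mp Matrix.isCompact_unitaryGroup
  haveI : CompactSpace (Matrix.unitaryGroup β ℂ) := isCompact_iff_compactSpace.mp Matrix.isCompact_unitaryGroup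
  refine isProperMap_of_comp_of_t2 (continuous_kakMap p₀ q₀) (continuous_gauge q₀) ?_
  have h : gauge q₀ ∘ (kakMap p₀ q₀ : KV α β × ℝ × KV α β → UForm α β) =
      Real.cosh ∘ (Prod.fst ∘ Prod.snd) := funext (gauge_kakMap p₀ q₀)
  rw [h]
  exact isProperMap_cosh.comp (isProperMap_fst_of_compactSpace.comp isProperMap_snd_of_compactSpace)

/-- **`kakMap` is a closed map** (`β` a singleton). [folklore] -/
theorem isClosedMap_kakMap [Subsingleton β] : IsClosedMap (kakMap p₀ q₀ : KV α β × ℝ × KV α β → UForm α β) :=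
  (isProperMap_kakMap p₀ q₀).isClosedMap

/-- the preimage of a compact set under `kakMap` is compact (`β` a singleton). [folklore] -/
theorem isCompact_preimage_kakMap [Subsingleton β] {C : Set (UForm α β)} (hC : IsCompact C) :
    IsCompact ((kakMap p₀ q₀ : KV α β × ℝ × KV α β → UForm α β) ⁻¹' C) :=
  (isProperMap_kakMap p₀ q₀).isCompact_preimage hC

end Proper

/-! ## 6. The Weyl element: `w a_t w⁻¹ = a_{−t}` -/

section Weyl

variable {α β : Type*} [Fintype α] [DecidableEq α] [Fintype β] [DecidableEq β] (p₀ : α) (q₀ : β)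

/-- the sign matrix `diag(−1 at p₀, 1 elsewhere) ∈ U(α)`. [folklore] -/
def signAt : Matrix.unitaryGroup α ℂ :=
  ⟨Matrix.diagonal fun a => if a = p₀ then -1 else 1, by
    rw [Matrix.mem_unitaryGroup_iff, Matrix.star_eq_conjTranspose, Matrix.diagonal_conjTranspose,
      Matrix.diagonal_mul_diagonal, ← Matrix.diagonal_one]
    congr 1
    funext a
    by_cases h : a = p₀ <;> simp [h]⟩

/-- matrix of `signAt p₀`. [folklore] -/
@[simp] theorem coe_signAt :
    ((signAt p₀ : Matrix.unitaryGroup α ℂ) : Matrix α α ℂ) = Matrix.diagonal fun a => if a = p₀ then -1 else 1 :=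
  rfl

/-- **the Weyl element** `w = (diag(−1 at p₀, 1 elsewhere), 1) ∈ K = U(α) × U(β)`: it reverses the
hyperbolic one-parameter group, `w a_t w⁻¹ = a_{−t}`. [folklore] -/
def weylKV : KV α β := (signAt p₀, 1)

/-- matrix of `kV w`: the diagonal sign matrix `diag(−1 at inl p₀, 1 elsewhere)`. [folklore] -/
theorem coe_kV_weylKV :
    (((UForm.kV α β (weylKV p₀) : UForm α β) : GL (α ⊕ β) ℂ) : Matrix (α ⊕ β) (α ⊕ β) ℂ) =
      Matrix.diagonal (Sum.elim (fun a => if a = p₀ then (-1 : ℂ) else 1) fun _ => 1) := by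
  rw [UForm.coe_kV]
  simp only [weylKV, coe_signAt, OneMemClass.coe_one]
  rw [← Matrix.diagonal_one, Matrix.fromBlocks_diagonal]

/-- **the Weyl relation, product form**: `w · a_t = a_{−t} · w`. [folklore] -/
theorem kV_weylKV_mul_hypV (t : ℝ) :
    UForm.kV α β (weylKV p₀) * hypV p₀ q₀ t = hypV p₀ q₀ (-t) * UForm.kV α β (weylKV p₀) := by
  apply Subtype.ext
  apply Units.ext
  change (((UForm.kV α β (weylKV p₀) * hypV p₀ q₀ t : UForm α β) : GL (α ⊕ β) ℂ) :
      Matrix (α ⊕ β) (α ⊕ β) ℂ) =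
    (((hypV p₀ q₀ (-t) * UForm.kV α β (weylKV p₀) : UForm α β) : GL (α ⊕ β) ℂ) : Matrix (α ⊕ β) (α ⊕ β) ℂ)
  rw [UForm.coe_mul, UForm.coe_mul, coe_kV_weylKV]
  ext i j
  rw [Matrix.diagonal_mul, Matrix.mul_diagonal]
  rcases i with a | b <;> rcases j with a' | b'
  · simp only [Sum.elim_inl, hypV_inl_inl, Real.cosh_neg]
    split_ifs <;> simp_all
  · simp only [Sum.elim_inl, Sum.elim_inr, hypV_inl_inr, Real.sinh_neg, Complex.ofReal_neg]
    split_ifs <;> simp_all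
  · simp only [Sum.elim_inl, Sum.elim_inr, hypV_inr_inl, Real.sinh_neg, Complex.ofReal_neg]
    split_ifs <;> simp_all
  · simp only [Sum.elim_inr, hypV_inr_inr, Real.cosh_neg, one_mul, mul_one]

/-- **the Weyl relation**: `w · a_t · w⁻¹ = a_{−t}`. [folklore] -/
theorem kV_weylKV_mul_hypV_mul_inv (t : ℝ) :
    UForm.kV α β (weylKV p₀) * hypV p₀ q₀ t * (UForm.kV α β (weylKV p₀))⁻¹ = hypV p₀ q₀ (-t) := by
  rw [mul_inv_eq_iff_eq_mul, kV_weylKV_mul_hypV]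

/-- **existence of a Weyl element in `K`** reversing the one-parameter group `a_t`. [folklore] -/
theorem exists_weyl :
    ∃ w : KV α β, ∀ t : ℝ, UForm.kV α β w * hypV p₀ q₀ t * (UForm.kV α β w)⁻¹ = hypV p₀ q₀ (-t) :=
  ⟨weylKV p₀, kV_weylKV_mul_hypV_mul_inv p₀ q₀⟩

end Weyl

/-! ## 7. Surjectivity: `U(α,β) = K · {a_t : t ≥ 0} · K` when `|β| = 1` -/

section Surj

variable {α β : Type*} [Fintype α] [DecidableEq α] [Fintype β] [DecidableEq β] (p₀ : α) (q₀ : β)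

/-- **a unit vector is the `p₀`-th column of a unitary matrix** (extend it to an orthonormal basis of `ℂ^α`).
[folklore] -/
theorem exists_unitaryGroup_col_eq (w : α → ℂ) (hw : ∑ a, ‖w a‖ ^ 2 = 1) :
    ∃ u : Matrix.unitaryGroup α ℂ, ∀ a, (u : Matrix α α ℂ) a p₀ = w a := by
  let x : EuclideanSpace ℂ α := WithLp.toLp 2 w
  have hx : ‖x‖ = 1 := by
    rw [EuclideanSpace.norm_eq, Real.sqrt_eq_one]
    exact hw
  have h : Orthonormal ℂ (({p₀} : Set α).restrict fun _ : α => x) := by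
    refine ⟨fun i => by simpa using hx, ?_⟩
    intro i j hij
    exact absurd (Subsingleton.elim i j) hij
  obtain ⟨b, hb⟩ := h.exists_orthonormalBasis_extension_of_card_eq (E := EuclideanSpace ℂ α)
    finrank_euclideanSpace
  refine ⟨⟨(EuclideanSpace.basisFun α ℂ).toBasis.toMatrix b,
    (EuclideanSpace.basisFun α ℂ).toMatrix_orthonormalBasis_mem_unitary b⟩, fun a => ?_⟩
  change ((EuclideanSpace.basisFun α ℂ).toBasis.toMatrix b) a p₀ = w a
  rw [Module.Basis.toMatrix_apply, OrthonormalBasis.coe_toBasis_repr_apply, EuclideanSpace.basisFun_repr,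
    hb p₀ (Set.mem_singleton p₀)]

/-- a unit complex number `z` as the element `z • 1 ∈ U(β)` (used for `|β| = 1`, where `U(β) = U(1)`). [folklore] -/
def unitaryScalar (z : ℂ) (hz : ‖z‖ = 1) : Matrix.unitaryGroup β ℂ :=
  ⟨z • (1 : Matrix β β ℂ), by
    rw [Matrix.mem_unitaryGroup_iff, star_smul, star_one, Matrix.smul_mul, Matrix.mul_smul, one_mul, smul_smul,
      Complex.star_def, Complex.mul_conj', hz]
    simp⟩

/-- entry of `unitaryScalar z`. [folklore] -/
@[simp] theorem unitaryScalar_apply [Subsingleton β] (z : ℂ) (hz : ‖z‖ = 1) (b b' : β) :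
    ((unitaryScalar z hz : Matrix.unitaryGroup β ℂ) : Matrix β β ℂ) b b' = z := by
  change (z • (1 : Matrix β β ℂ)) b b' = z
  rw [Matrix.smul_apply, Subsingleton.elim b' b, Matrix.one_apply_eq, smul_eq_mul, mul_one]

/-- **the `q₀`-column of `k · a_t`** (`|β| = 1`, `k = (u, z)`): entries `u_{a p₀} · (−sinh t · i)` above and
`z_{q₀q₀} · cosh t` at the bottom. [folklore] -/
theorem kV_mul_hypV_col [Subsingleton β] (k : KV α β) (t : ℝ) :
    (∀ a, (((UForm.kV α β k * hypV p₀ q₀ t : UForm α β) : GL (α ⊕ β) ℂ) : Matrix (α ⊕ β) (α ⊕ β) ℂ)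
        (Sum.inl a) (Sum.inr q₀) = (k.1 : Matrix α α ℂ) a p₀ * (-(Real.sinh t : ℂ) * I)) ∧
      (((UForm.kV α β k * hypV p₀ q₀ t : UForm α β) : GL (α ⊕ β) ℂ) : Matrix (α ⊕ β) (α ⊕ β) ℂ)
        (Sum.inr q₀) (Sum.inr q₀) = (k.2 : Matrix β β ℂ) q₀ q₀ * (Real.cosh t : ℂ) := by
  constructor
  · intro a
    rw [UForm.coe_mul, Matrix.mul_apply, Fintype.sum_sum_type]
    simp only [UForm.coe_kV, Matrix.fromBlocks_apply₁₁, Matrix.fromBlocks_apply₁₂, Matrix.zero_apply, zero_mul,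
      Finset.sum_const_zero, add_zero, hypV_inl_inr, and_true]
    rw [Finset.sum_eq_single p₀ (fun a' _ ha' => by rw [if_neg ha', mul_zero])
      (fun h => absurd (Finset.mem_univ p₀) h), if_pos rfl]
  · rw [UForm.coe_mul, Matrix.mul_apply, Fintype.sum_sum_type]
    simp only [UForm.coe_kV, Matrix.fromBlocks_apply₂₁, Matrix.fromBlocks_apply₂₂, Matrix.zero_apply, zero_mul,
      Finset.sum_const_zero, zero_add, hypV_inr_inr, if_true, Fintype.sum_subsingleton _ q₀]

/-- **the stabiliser of `e_{q₀}` is `U(α) × 1`** (`|β| = 1`): an element of `U(α,β)` whose `q₀`-column is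
`e_{q₀}` is `diag(u, 1)`.  (From `gᴴ J g = J`: the `(q₀, α)` entries kill the bottom row, the `(α, α)` entries
make the `α`-block unitary.) [folklore] -/
theorem exists_eq_kV_of_col_eq [Subsingleton β] (h : UForm α β)
    (h1 : ∀ a, (((h : UForm α β) : GL (α ⊕ β) ℂ) : Matrix (α ⊕ β) (α ⊕ β) ℂ) (Sum.inl a) (Sum.inr q₀) = 0)
    (h2 : (((h : UForm α β) : GL (α ⊕ β) ℂ) : Matrix (α ⊕ β) (α ⊕ β) ℂ) (Sum.inr q₀) (Sum.inr q₀) = 1) :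
    ∃ u : Matrix.unitaryGroup α ℂ, h = UForm.kV α β (u, 1) := by
  set M := (((h : UForm α β) : GL (α ⊕ β) ℂ) : Matrix (α ⊕ β) (α ⊕ β) ℂ) with hM
  have hrow : ∀ a', M (Sum.inr q₀) (Sum.inl a') = 0 := fun a' => by
    have e := UForm.form_apply h (Sum.inr q₀) (Sum.inl a')
    simp only [← hM, Fintype.sum_subsingleton _ q₀, h1, star_zero, zero_mul, Finset.sum_const_zero, h2, star_one,
      one_mul, zero_sub, Matrix.fromBlocks_apply₂₁, Matrix.zero_apply, neg_eq_zero] at e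
    exact e
  let A : Matrix α α ℂ := fun a a' => M (Sum.inl a) (Sum.inl a')
  have hA : A ∈ Matrix.unitaryGroup α ℂ := by
    rw [Matrix.mem_unitaryGroup_iff']
    ext a₁ a₂
    have e := UForm.form_apply h (Sum.inl a₁) (Sum.inl a₂)
    simp only [← hM, Fintype.sum_subsingleton _ q₀, hrow, star_zero, zero_mul, sub_zero,
      Matrix.fromBlocks_apply₁₁] at e
    rw [Matrix.mul_apply]
    exact e
  refine ⟨⟨A, hA⟩, Subtype.ext (Units.ext ?_)⟩
  change M = (((UForm.kV α β (⟨A, hA⟩, 1) : UForm α β) : GL (α ⊕ β) ℂ) : Matrix (α ⊕ β) (α ⊕ β) ℂ)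
  rw [UForm.coe_kV]
  ext i j
  rcases i with a | b <;> rcases j with a' | b'
  · rfl
  · rw [Matrix.fromBlocks_apply₁₂, Matrix.zero_apply, Subsingleton.elim b' q₀, h1]
  · rw [Matrix.fromBlocks_apply₂₁, Matrix.zero_apply, Subsingleton.elim b q₀, hrow]
  · rw [Matrix.fromBlocks_apply₂₂, OneMemClass.coe_one, Subsingleton.elim b q₀, Subsingleton.elim b' q₀,
      Matrix.one_apply_eq, h2]

/-- **column matching**: for every `g ∈ U(α,β)` (`|β| = 1`) there are `k ∈ K` and `t ≥ 0` such that `k · a_t`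
has the same `q₀`-column as `g` (`sinh t = ‖v‖`, `cosh t = |x|` for the column `(v, x)` of `g`, which satisfies
`|x|² − ‖v‖² = 1`). [folklore] -/
theorem exists_kV_mul_hypV_col_eq [Subsingleton β] (g : UForm α β) :
    ∃ k : KV α β, ∃ t : ℝ, 0 ≤ t ∧ ∀ i,
      (((UForm.kV α β k * hypV p₀ q₀ t : UForm α β) : GL (α ⊕ β) ℂ) : Matrix (α ⊕ β) (α ⊕ β) ℂ) i (Sum.inr q₀) =
        (((g : UForm α β) : GL (α ⊕ β) ℂ) : Matrix (α ⊕ β) (α ⊕ β) ℂ) i (Sum.inr q₀) := by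
  set M := (((g : UForm α β) : GL (α ⊕ β) ℂ) : Matrix (α ⊕ β) (α ⊕ β) ℂ) with hM
  set v : α → ℂ := fun a => M (Sum.inl a) (Sum.inr q₀) with hv
  set x : ℂ := M (Sum.inr q₀) (Sum.inr q₀) with hx
  set S : ℝ := ∑ a, ‖v a‖ ^ 2 with hS
  have hS0 : 0 ≤ S := Finset.sum_nonneg fun a _ => sq_nonneg _
  -- the hyperboloid relation `|x|² = 1 + S`
  have hrel : ‖x‖ ^ 2 = 1 + S := by
    have e := UForm.form_apply g (Sum.inr q₀) (Sum.inr q₀)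
    simp only [← hM, Fintype.sum_subsingleton _ q₀, Matrix.fromBlocks_apply₂₂, Matrix.neg_apply,
      Matrix.one_apply_eq, Complex.star_def, Complex.conj_mul'] at e
    have e' : ((‖x‖ ^ 2 : ℝ) : ℂ) = ((1 + S : ℝ) : ℂ) := by
      rw [hS]; push_cast
      have : ∑ a, (‖v a‖ : ℂ) ^ 2 = ∑ a, (‖M (Sum.inl a) (Sum.inr q₀)‖ : ℂ) ^ 2 := rfl
      rw [this]; linear_combination (-1 : ℂ) * e
    exact_mod_cast e'
  have hxn : ‖x‖ = √(1 + S) := by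
    rw [← hrel, Real.sqrt_sq (norm_nonneg _)]
  have hx0 : ‖x‖ ≠ 0 := by
    rw [hxn]; exact (Real.sqrt_pos.2 (by linarith)).ne'
  have hx0' : x ≠ 0 := fun h => hx0 (by rw [h, norm_zero])
  -- the parameter `t = arsinh √S ≥ 0`
  set t : ℝ := Real.arsinh (√S) with ht
  have ht0 : 0 ≤ t := Real.arsinh_nonneg_iff.2 (Real.sqrt_nonneg _)
  have hsinh : Real.sinh t = √S := Real.sinh_arsinh _
  have hcosh : Real.cosh t = ‖x‖ := by rw [ht, Real.cosh_arsinh, Real.sq_sqrt hS0, hxn]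
  -- the `β`-component: the phase of `x`
  have hz : ‖x / (‖x‖ : ℂ)‖ = 1 := by
    rw [norm_div, Complex.norm_real, Real.norm_eq_abs, abs_of_nonneg (norm_nonneg _), div_self hx0]
  -- the `α`-component
  obtain ⟨u, hu⟩ : ∃ u : Matrix.unitaryGroup α ℂ, ∀ a, (u : Matrix α α ℂ) a p₀ * (-(Real.sinh t : ℂ) * I) = v a := by
    by_cases hS1 : S = 0
    · refine ⟨1, fun a => ?_⟩
      have hva : v a = 0 := by
        have := Finset.sum_eq_zero_iff_of_nonneg (fun a _ => sq_nonneg ‖v a‖) |>.1 (hS ▸ hS1) a (Finset.mem_univ a)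
        exact norm_eq_zero.1 (pow_eq_zero_iff two_ne_zero |>.1 this)
      rw [hva, hsinh, hS1, Real.sqrt_zero, Complex.ofReal_zero, neg_zero, zero_mul, mul_zero]
    · have hr : (0 : ℝ) < √S := Real.sqrt_pos.2 (lt_of_le_of_ne hS0 (Ne.symm hS1))
      have hr' : (√S : ℂ) ≠ 0 := by exact_mod_cast hr.ne'
      obtain ⟨u, hu⟩ := exists_unitaryGroup_col_eq p₀ (fun a => I / (√S : ℂ) * v a) (by
        have : ∀ a, ‖I / (√S : ℂ) * v a‖ ^ 2 = (S)⁻¹ * ‖v a‖ ^ 2 := fun a => by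
          rw [norm_mul, norm_div, Complex.norm_I, Complex.norm_real, Real.norm_eq_abs, abs_of_pos hr, mul_pow,
            div_pow, one_pow, Real.sq_sqrt hS0, one_div]
        simp_rw [this, ← Finset.mul_sum]
        rw [← hS, inv_mul_cancel₀ hS1])
      refine ⟨u, fun a => ?_⟩
      rw [hu a, hsinh]
      field_simp
      rw [Complex.I_sq]; ring
  refine ⟨(u, unitaryScalar (x / (‖x‖ : ℂ)) hz), t, ht0, fun i => ?_⟩
  obtain ⟨hcol₁, hcol₂⟩ := kV_mul_hypV_col p₀ q₀ ((u, unitaryScalar (x / (‖x‖ : ℂ)) hz) : KV α β) t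
  rcases i with a | b
  · rw [hcol₁ a, hu a]
  · rw [Subsingleton.elim b q₀, hcol₂, unitaryScalar_apply, hcosh, div_mul_cancel₀ _ (by exact_mod_cast hx0)]

/-- **`KAK` decomposition, real rank one** (`|β| = 1`): every `g ∈ U(α,β)` is `k₁ · a_t · k₂` with `k₁, k₂ ∈ K =
U(α) × U(β)` and `t ≥ 0` — the Cartan decomposition `G = K A⁺ K` (Knapp, *Lie Groups Beyond an Introduction*,
Thm. 7.39) for `U(n,1)`, here by the elementary column argument (match the `q₀`-column of `g` by `k₁ a_t`, then
`(k₁ a_t)⁻¹ g` fixes `e_{q₀}` and lies in `U(α) × 1`). [cite: Knapp2002, Thm 7.39] -/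
theorem exists_kV_mul_hypV_mul_kV_eq [Subsingleton β] (g : UForm α β) :
    ∃ k₁ k₂ : KV α β, ∃ t : ℝ, 0 ≤ t ∧ g = UForm.kV α β k₁ * hypV p₀ q₀ t * UForm.kV α β k₂ := by
  obtain ⟨k₁, t, ht0, hX⟩ := exists_kV_mul_hypV_col_eq p₀ q₀ g
  set X : UForm α β := UForm.kV α β k₁ * hypV p₀ q₀ t with hXdef
  have hcol : ∀ i, (((X⁻¹ * g : UForm α β) : GL (α ⊕ β) ℂ) : Matrix (α ⊕ β) (α ⊕ β) ℂ) i (Sum.inr q₀) =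
      (1 : Matrix (α ⊕ β) (α ⊕ β) ℂ) i (Sum.inr q₀) := fun i => by
    rw [UForm.coe_mul, Matrix.mul_apply, Finset.sum_congr rfl fun k _ => by rw [← hX k], ← Matrix.mul_apply,
      ← UForm.coe_mul, inv_mul_cancel, UForm.coe_one]
  obtain ⟨u, hu⟩ := exists_eq_kV_of_col_eq q₀ (X⁻¹ * g)
    (fun a => by rw [hcol, Matrix.one_apply_ne Sum.inl_ne_inr]) (by rw [hcol, Matrix.one_apply_eq])
  exact ⟨k₁, (u, 1), t, ht0, by rw [← inv_mul_eq_iff_eq_mul.1 hu]⟩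

/-- **`kakMap` is surjective** (`|β| = 1`). [folklore] -/
theorem kakMap_surjective [Subsingleton β] :
    Function.Surjective (kakMap p₀ q₀ : KV α β × ℝ × KV α β → UForm α β) := fun g => by
  obtain ⟨k₁, k₂, t, -, hg⟩ := exists_kV_mul_hypV_mul_kV_eq p₀ q₀ g
  exact ⟨(k₁, t, k₂), hg.symm⟩

/-- surjectivity already from `t ≥ 0`: the range of `kakMap` on `K × [0, ∞) × K` is everything. [folklore] -/
theorem kakMap_image_nonneg [Subsingleton β] :
    (kakMap p₀ q₀ : KV α β × ℝ × KV α β → UForm α β) '' {x | 0 ≤ x.2.1} = Set.univ := by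
  refine Set.eq_univ_of_forall fun g => ?_
  obtain ⟨k₁, k₂, t, ht, hg⟩ := exists_kV_mul_hypV_mul_kV_eq p₀ q₀ g
  exact ⟨(k₁, t, k₂), ht, hg.symm⟩

end Surj

/-! ## 8. Quotient-map corollaries: continuity on `U(α,β)` is continuity in `(k₁, t, k₂)` -/

section Quotient

variable {α β : Type*} [Fintype α] [DecidableEq α] [Fintype β] [DecidableEq β] (p₀ : α) (q₀ : β)

/-- **`kakMap` is a quotient map** (`|β| = 1`): closed, continuous, surjective. [folklore] -/
theorem isQuotientMap_kakMap [Subsingleton β] :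
    Topology.IsQuotientMap (kakMap p₀ q₀ : KV α β × ℝ × KV α β → UForm α β) :=
  (isClosedMap_kakMap p₀ q₀).isQuotientMap (continuous_kakMap p₀ q₀) (kakMap_surjective p₀ q₀)

/-- `kakMap × id_X` is a proper map for every space `X` (`|β| = 1`). [folklore] -/
theorem isProperMap_kakMap_prodMap [Subsingleton β] (X : Type*) [TopologicalSpace X] :
    IsProperMap (Prod.map (kakMap p₀ q₀ : KV α β × ℝ × KV α β → UForm α β) (id : X → X)) :=
  (isProperMap_kakMap p₀ q₀).prodMap isProperMap_id

/-- **`kakMap × id_X` is a quotient map** for every space `X` (`|β| = 1`) — the form used to descend JOINT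
continuity of `(g, f) ↦ ω(g) f`. [folklore] -/
theorem isQuotientMap_kakMap_prodMap [Subsingleton β] (X : Type*) [TopologicalSpace X] :
    Topology.IsQuotientMap (Prod.map (kakMap p₀ q₀ : KV α β × ℝ × KV α β → UForm α β) (id : X → X)) :=
  (isProperMap_kakMap_prodMap p₀ q₀ X).isClosedMap.isQuotientMap
    ((continuous_kakMap p₀ q₀).prodMap continuous_id)
    ((kakMap_surjective p₀ q₀).prodMap Function.surjective_id)

/-- **descent of continuity along `KAK`**: a map out of `U(α,β)` (`|β| = 1`) is continuous iff it is continuous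
as a function of `(k₁, t, k₂)`. [folklore] -/
theorem continuous_iff_comp_kakMap [Subsingleton β] {Z : Type*} [TopologicalSpace Z] {f : UForm α β → Z} :
    Continuous f ↔ Continuous (f ∘ (kakMap p₀ q₀ : KV α β × ℝ × KV α β → UForm α β)) :=
  (isQuotientMap_kakMap p₀ q₀).continuous_iff

/-- **descent of joint continuity along `KAK × id`**: a map out of `U(α,β) × X` (`|β| = 1`) is continuous iff
it is continuous as a function of `((k₁, t, k₂), x)`. [folklore] -/
theorem continuous_iff_comp_kakMap_prodMap [Subsingleton β] {X Z : Type*} [TopologicalSpace X]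
    [TopologicalSpace Z] {f : UForm α β × X → Z} :
    Continuous f ↔
      Continuous (f ∘ Prod.map (kakMap p₀ q₀ : KV α β × ℝ × KV α β → UForm α β) (id : X → X)) :=
  (isQuotientMap_kakMap_prodMap p₀ q₀ X).continuous_iff

end Quotient

/-! ## 9. The dual pair `U(P,Q) × U(R,S)`: both factors of real rank one -/

section Pair

variable {P Q R S : Type*} [Fintype P] [DecidableEq P] [Fintype Q] [DecidableEq Q]
  [Fintype R] [DecidableEq R] [Fintype S] [DecidableEq S] (p₀ : P) (q₀ : Q) (r₀ : R) (s₀ : S)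

/-- the embedded `SL(2,ℝ)` of `RealUnitaryDualPairSL2` on the diagonal torus is `(a_t, 1)`:
`φ (diag(eᵗ, e⁻ᵗ)) = (hypV p₀ q₀ t, 1)`. [folklore] -/
theorem φ_slExp (t : ℝ) : φ R S p₀ q₀ (slExp t) = ((hypV p₀ q₀ t : UForm P Q), (1 : UForm R S)) := rfl

/-- **the two-parameter `KAK` map of the pair**: `((k, (t, s), k') ↦ κ k · (a_t, a'_s) · κ k'`,
`K × K′ = (U(P) × U(Q)) × (U(R) × U(S))`. [folklore] -/
def kakMap₂ (x : DPK P Q R S × (ℝ × ℝ) × DPK P Q R S) : Ginf P Q R S :=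
  κ P Q R S x.1 * ((hypV p₀ q₀ x.2.1.1 : UForm P Q), (hypV r₀ s₀ x.2.1.2 : UForm R S)) * κ P Q R S x.2.2

/-- the coordinate shuffle `((k₁,k₁'), (t,s), (k₂,k₂')) ↦ ((k₁,t,k₂), (k₁',s,k₂'))`, a homeomorphism. [folklore] -/
def kakShuffle :
    DPK P Q R S × (ℝ × ℝ) × DPK P Q R S ≃ₜ (KV P Q × ℝ × KV P Q) × (KV R S × ℝ × KV R S) where
  toFun x := ((x.1.1, x.2.1.1, x.2.2.1), (x.1.2, x.2.1.2, x.2.2.2))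
  invFun y := ((y.1.1, y.2.1), (y.1.2.1, y.2.2.1), (y.1.2.2, y.2.2.2))
  left_inv _ := rfl
  right_inv _ := rfl
  continuous_toFun := by fun_prop
  continuous_invFun := by fun_prop

/-- `kakMap₂` is the product of the two one-factor `kakMap`s after the shuffle. [folklore] -/
theorem kakMap₂_eq :
    (kakMap₂ p₀ q₀ r₀ s₀ : DPK P Q R S × (ℝ × ℝ) × DPK P Q R S → Ginf P Q R S) =
      Prod.map (kakMap p₀ q₀) (kakMap r₀ s₀) ∘ kakShuffle := rfl

/-- `kakMap₂` is continuous. [folklore] -/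
theorem continuous_kakMap₂ :
    Continuous (kakMap₂ p₀ q₀ r₀ s₀ : DPK P Q R S × (ℝ × ℝ) × DPK P Q R S → Ginf P Q R S) := by
  rw [kakMap₂_eq]
  exact ((continuous_kakMap p₀ q₀).prodMap (continuous_kakMap r₀ s₀)).comp kakShuffle.continuous

/-- **`kakMap₂` is a proper map** (`|Q| = |S| = 1`). [folklore] -/
theorem isProperMap_kakMap₂ [Subsingleton Q] [Subsingleton S] :
    IsProperMap (kakMap₂ p₀ q₀ r₀ s₀ : DPK P Q R S × (ℝ × ℝ) × DPK P Q R S → Ginf P Q R S) := by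
  rw [kakMap₂_eq]
  exact ((isProperMap_kakMap p₀ q₀).prodMap (isProperMap_kakMap r₀ s₀)).comp kakShuffle.isProperMap

/-- **`kakMap₂` is surjective** (`|Q| = |S| = 1`). [folklore] -/
theorem kakMap₂_surjective [Subsingleton Q] [Subsingleton S] :
    Function.Surjective (kakMap₂ p₀ q₀ r₀ s₀ : DPK P Q R S × (ℝ × ℝ) × DPK P Q R S → Ginf P Q R S) := by
  rw [kakMap₂_eq]
  exact ((kakMap_surjective p₀ q₀).prodMap (kakMap_surjective r₀ s₀)).comp kakShuffle.surjective

/-- **`kakMap₂` is a quotient map** (`|Q| = |S| = 1`). [folklore] -/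
theorem isQuotientMap_kakMap₂ [Subsingleton Q] [Subsingleton S] :
    Topology.IsQuotientMap (kakMap₂ p₀ q₀ r₀ s₀ : DPK P Q R S × (ℝ × ℝ) × DPK P Q R S → Ginf P Q R S) :=
  (isProperMap_kakMap₂ p₀ q₀ r₀ s₀).isClosedMap.isQuotientMap (continuous_kakMap₂ p₀ q₀ r₀ s₀)
    (kakMap₂_surjective p₀ q₀ r₀ s₀)

/-- **`kakMap₂ × id_X` is a quotient map** for every space `X` (`|Q| = |S| = 1`). [folklore] -/
theorem isQuotientMap_kakMap₂_prodMap [Subsingleton Q] [Subsingleton S] (X : Type*) [TopologicalSpace X] :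
    Topology.IsQuotientMap
      (Prod.map (kakMap₂ p₀ q₀ r₀ s₀ : DPK P Q R S × (ℝ × ℝ) × DPK P Q R S → Ginf P Q R S) (id : X → X)) :=
  ((isProperMap_kakMap₂ p₀ q₀ r₀ s₀).prodMap isProperMap_id).isClosedMap.isQuotientMap
    ((continuous_kakMap₂ p₀ q₀ r₀ s₀).prodMap continuous_id)
    ((kakMap₂_surjective p₀ q₀ r₀ s₀).prodMap Function.surjective_id)

/-- the Weyl elements of the pair: `(w, 1)` reverses `(a_t, 1)` and `(1, w′)` reverses `(1, a′_s)`. [folklore] -/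
theorem κ_weyl_conj (t s : ℝ) :
    κ P Q R S (weylKV p₀, weylKV r₀) * ((hypV p₀ q₀ t : UForm P Q), (hypV r₀ s₀ s : UForm R S)) *
        (κ P Q R S (weylKV p₀, weylKV r₀))⁻¹ =
      ((hypV p₀ q₀ (-t) : UForm P Q), (hypV r₀ s₀ (-s) : UForm R S)) :=
  Prod.ext (kV_weylKV_mul_hypV_mul_inv p₀ q₀ t) (kV_weylKV_mul_hypV_mul_inv r₀ s₀ s)

end Pair

/-! ## 10. The pair with a compact second factor: `U(P,Q) × U(R,S)`, `|Q| = 1`, `K′ = U(R) × U(S) ↠ U(R,S)`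

This is the shape of the archimedean pair `(U(2,1), U(1))`: `(P,Q,R,S) = (Fin 2, Unit, Unit, Empty)`. -/

section CompactFactor

variable {P Q R S : Type*} [Fintype P] [DecidableEq P] [Fintype Q] [DecidableEq Q]
  [Fintype R] [DecidableEq R] [Fintype S] [DecidableEq S] (p₀ : P) (q₀ : Q)

/-- **the `KAK` map of the pair along the `V`-torus**: `(k, t, k') ↦ κ k · φ(diag(eᵗ,e⁻ᵗ)) · κ k'`,
`K × K′ = (U(P) × U(Q)) × (U(R) × U(S))`, `φ = φ R S p₀ q₀` the embedded `SL(2,ℝ)` of the plane `{e_{p₀}, e_{q₀}}`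
of `V` (so the middle factor is `(a_t, 1)`, `φ_slExp`). [folklore] -/
def kakMapPair (x : DPK P Q R S × ℝ × DPK P Q R S) : Ginf P Q R S :=
  κ P Q R S x.1 * φ R S p₀ q₀ (slExp x.2.1) * κ P Q R S x.2.2

/-- unfolding `kakMapPair`. [folklore] -/
theorem kakMapPair_apply (k : DPK P Q R S) (t : ℝ) (k' : DPK P Q R S) :
    kakMapPair p₀ q₀ (k, t, k') = κ P Q R S k * φ R S p₀ q₀ (slExp t) * κ P Q R S k' := rfl

/-- the `W`-part of `kakMapPair`: `(k₂, k₂') ↦ k₂ · 1 · k₂'` on `K′ = U(R) × U(S)`. [folklore] -/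
def kMulW (y : KV R S × KV R S) : UForm R S := UForm.kV R S y.1 * 1 * UForm.kV R S y.2

/-- `kMulW` is continuous. [folklore] -/
theorem continuous_kMulW : Continuous (kMulW : KV R S × KV R S → UForm R S) :=
  ((UForm.continuous_kV.comp continuous_fst).mul continuous_const).mul (UForm.continuous_kV.comp continuous_snd)

/-- `kMulW` is proper (its source is compact). [folklore] -/
theorem isProperMap_kMulW : IsProperMap (kMulW : KV R S × KV R S → UForm R S) := by
  haveI : CompactSpace (Matrix.unitaryGroup R ℂ) := isCompact_iff_compactSpace.mp Matrix.isCompact_unitaryGroup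
  haveI : CompactSpace (Matrix.unitaryGroup S ℂ) := isCompact_iff_compactSpace.mp Matrix.isCompact_unitaryGroup
  exact continuous_kMulW.isProperMap

/-- `kMulW` is surjective as soon as `kV : U(R) × U(S) → U(R,S)` is (the case of a definite `W`, `S = ∅` or
`R = ∅`, where `U(R,S)` is its own maximal compact subgroup). [folklore] -/
theorem kMulW_surjective (hW : Function.Surjective (UForm.kV R S)) :
    Function.Surjective (kMulW : KV R S × KV R S → UForm R S) := fun g => by
  obtain ⟨k, hk⟩ := hW g
  exact ⟨(k, 1), by rw [kMulW, map_one, mul_one, mul_one, hk]⟩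

/-- the coordinate shuffle `((k₁,k₂), t, (k₁',k₂')) ↦ ((k₁,t,k₁'), (k₂,k₂'))`, a homeomorphism. [folklore] -/
def kakShufflePair : DPK P Q R S × ℝ × DPK P Q R S ≃ₜ (KV P Q × ℝ × KV P Q) × (KV R S × KV R S) where
  toFun x := ((x.1.1, x.2.1, x.2.2.1), (x.1.2, x.2.2.2))
  invFun y := ((y.1.1, y.2.1), y.1.2.1, (y.1.2.2, y.2.2))
  left_inv _ := rfl
  right_inv _ := rfl
  continuous_toFun := by fun_prop
  continuous_invFun := by fun_prop

/-- `kakMapPair` is `kakMap × kMulW` after the shuffle. [folklore] -/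
theorem kakMapPair_eq :
    (kakMapPair p₀ q₀ : DPK P Q R S × ℝ × DPK P Q R S → Ginf P Q R S) =
      Prod.map (kakMap p₀ q₀) kMulW ∘ kakShufflePair := rfl

/-- `kakMapPair` is continuous. [folklore] -/
theorem continuous_kakMapPair :
    Continuous (kakMapPair p₀ q₀ : DPK P Q R S × ℝ × DPK P Q R S → Ginf P Q R S) := by
  rw [kakMapPair_eq]
  exact ((continuous_kakMap p₀ q₀).prodMap continuous_kMulW).comp kakShufflePair.continuous

/-- **`kakMapPair` is a proper map** (`|Q| = 1`; no hypothesis on the `W`-factor). [folklore] -/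
theorem isProperMap_kakMapPair [Subsingleton Q] :
    IsProperMap (kakMapPair p₀ q₀ : DPK P Q R S × ℝ × DPK P Q R S → Ginf P Q R S) := by
  rw [kakMapPair_eq]
  exact ((isProperMap_kakMap p₀ q₀).prodMap isProperMap_kMulW).comp kakShufflePair.isProperMap

/-- **`kakMapPair` is surjective** when `|Q| = 1` and `K′ ↠ U(R,S)`. [folklore] -/
theorem kakMapPair_surjective [Subsingleton Q] (hW : Function.Surjective (UForm.kV R S)) :
    Function.Surjective (kakMapPair p₀ q₀ : DPK P Q R S × ℝ × DPK P Q R S → Ginf P Q R S) := by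
  rw [kakMapPair_eq]
  exact ((kakMap_surjective p₀ q₀).prodMap (kMulW_surjective hW)).comp kakShufflePair.surjective

/-- **`kakMapPair` is a quotient map** when `|Q| = 1` and `K′ ↠ U(R,S)`. [folklore] -/
theorem isQuotientMap_kakMapPair [Subsingleton Q] (hW : Function.Surjective (UForm.kV R S)) :
    Topology.IsQuotientMap (kakMapPair p₀ q₀ : DPK P Q R S × ℝ × DPK P Q R S → Ginf P Q R S) :=
  (isProperMap_kakMapPair p₀ q₀).isClosedMap.isQuotientMap (continuous_kakMapPair p₀ q₀)
    (kakMapPair_surjective p₀ q₀ hW)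

/-- **`kakMapPair × id_X` is a quotient map** for every space `X` (`|Q| = 1`, `K′ ↠ U(R,S)`). [folklore] -/
theorem isQuotientMap_kakMapPair_prodMap [Subsingleton Q] (hW : Function.Surjective (UForm.kV R S))
    (X : Type*) [TopologicalSpace X] :
    Topology.IsQuotientMap
      (Prod.map (kakMapPair p₀ q₀ : DPK P Q R S × ℝ × DPK P Q R S → Ginf P Q R S) (id : X → X)) :=
  ((isProperMap_kakMapPair p₀ q₀).prodMap isProperMap_id).isClosedMap.isQuotientMap
    ((continuous_kakMapPair p₀ q₀).prodMap continuous_id)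
    ((kakMapPair_surjective p₀ q₀ hW).prodMap Function.surjective_id)

/-- the Weyl element of the pair along the `V`-torus: `κ (w, 1)` reverses `φ (diag(eᵗ, e⁻ᵗ))`. [folklore] -/
theorem κ_weylKV_conj_φ_slExp (t : ℝ) :
    κ P Q R S (weylKV p₀, 1) * φ R S p₀ q₀ (slExp t) * (κ P Q R S (weylKV p₀, 1))⁻¹ = φ R S p₀ q₀ (slExp (-t)) :=
  Prod.ext (kV_weylKV_mul_hypV_mul_inv p₀ q₀ t) (by simp)

end CompactFactor

end RealDualPair

end Literature.RepresentationTheory.KonnoKonno2007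

end
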